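import Summits.BirchSwinnertonDyer.BirchSwinnertonDyer.Theorems.ErratumRoadFiveShimuraKolyvaginOrderBoundInertShiftCebotarev
import Literature.NumberTheory.EllipticCurves.HeegnerPointsKolyvaginPrimaryAnnihilatorAtPrimeProofs
import HarnessLib

/-!
# Crux `ShimuraKolyvaginOrderBoundAtThreeSurj` (item stmt-BirchSwinnertonDyer-19899) — Kolyvagin's SHARP annihilator
# `p^{M₀} · Ш(E/K)[p^∞] = 0` from the mod-`p^M` leaves (A) + (B) + (B₂) asked only at Kolyvagin primes of DEPTH `M + k`
# (the two-place-duality data of the ORDER machine, one level deeper): step (ii′) of the ORDER-form level shift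

Cell `bsd-stepL` (run/shared/lean/pub/bsd-stepL/), seat `bsd-stepL-shim3a` (prover g2), HELPER for
`Summit.BirchSwinnertonDyer.BirchSwinnertonDyer.Theses.ClassRecordThree.ShimuraKolyvaginOrderBoundAtThreeSurj`
(`--supports stmt-BirchSwinnertonDyer-19899 --as helper`). Road memo HOME/shim/SHIM3A-G2-ROAD-19899.md §2 (γ₃′).
Companions: `…SurjOrderCebShift` (p484973, kernel-form Čebotarev at depth `M + k`), `…SurjOrderDictShift` (p485208,
the one-place dictionary at depth `M + k`), shim-p1 g8's `…InertShiftCebotarev` ∕ `…InertShiftDescent` (p480700 ∕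
p481169: Cor. 3.2 and the one-place descent at depth `M + k`).

## What

x11b3's ORDER machine at one prime (`KolyvaginOrder.card_sha_primary_le_at_of_leavesM₂_of_localDuality`, re-keyed
on the conductor by this seat as `…_of_conductorNorm`, p481548) takes its `hL` (`Ш[p^{2M₀}] ⊆ Ш[p^{M₀}]`) and `hkill`
(`p^{M₀} Sel ⊆ ℤ δx₀`) from Kolyvagin's SHARP annihilator, which needs the TWO-place duality leaf (B₂) and the data
`exists_hypothesesM₂_of_leavesM` ∕ `pow_smul_sha_primary_eq_zero_at_of_leavesM₂` (`…PrimaryAnnihilatorLeavesProofs`,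
`…PrimaryAnnihilatorAtPrimeProofs`). This file gives their twins with the Kolyvagin-prime predicate ONE LEVEL DEEPER
(`IsKolyvaginPrime N W K p ℓ ∧ FrobEqFrobInfty W K (p^(M+k)) ℓ`): statements = the tree's with that substitution and the
extra binder `k`; proofs = the tree's token for token, the `cebotarev` field supplied by shim-p1's
`McCallum1991_cor_3_2_pow_shift_of_chebotarev` (the abstract `HypothesesM` theory — `pow_M₀_zsmul_mem_zmultiples`,
`pow_M₀_smul_sha_primary_eq_zero_of_hypothesesM_of_le` — is generic in `Kol`). With `k = 0` they are the tree's.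

* `exists_hypothesesM₂_of_leavesM_shift`, `pow_smul_sha_primary_eq_zero_at_of_leavesM₂_shift`.

## Honest framing

THEOREMS ONLY (no `def`, no named fact, no `sorry`; axioms standard). Nothing here runs the ORDER machine at depth
`M + k` (step (iii) of the road memo: re-key of the conductor-keyed parts 1, 4–8 with the deep predicate); item 19899
stays OPEN. BSD is not proved by any of this.

## References

[cite: McCallumLMS1991, §1 Theorem (Kolyvagin), Lemma 5.1, §2 Prop. 2.2, §3 Cor. 3.2, §4 (6), Lemma 4.3, Prop. 4.4, Lemma 4.6, §5 Lemma 5.3, proof of Prop. 5.2]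
[cite: GrossLMS1991, §1 Thm. 1.3 (2), Props. 5.3, 5.4 (2), §10]
presearch: not applicable (re-keying of tree constructions). Tree: `lean search 'leavesM₂_shift'` → none.
-/

noncomputable section

open scoped Classical
set_option linter.dupNamespace false
namespace Summit.BirchSwinnertonDyer.BirchSwinnertonDyer.Theorems.ShimuraKolyvaginOrder

open WeierstrassCurve NumberField IsDedekindDomain
  Literature.NumberTheory.EllipticCurves Literature.NumberTheory.EllipticCurves.KolyvaginDescent
  Literature.NumberTheory.GaloisRepresentations
  Summit.BirchSwinnertonDyer.BirchSwinnertonDyer.Theorems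

variable {N : ℕ} [NeZero N] (W : WeierstrassCurve ℚ) {K : Type} [Field K] [NumberField K]

/-- **The tree's `exists_hypothesesM₂_of_leavesM` at DEPTH `M + k`** (same construction, field for field, with
`Kol ℓ := IsKolyvaginPrime N W K p ℓ ∧ FrobEqFrobInfty W K (p^(M+k)) ℓ`; leaves (A), (B), (B₂) asked at depth-`(M+k)`
primes; Čebotarev field from shim-p1's `McCallum1991_cor_3_2_pow_shift_of_chebotarev`), returning the abstract
two-place duality of the produced data. [cite: McCallumLMS1991, §4 (6), Lemma 4.3, Prop. 4.4; §5 Lemma 5.1, Lemma 5.3; §2 Prop. 2.2; §3 Cor. 3.2]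
[cite: GrossLMS1991, Props. 5.3, 5.4 (2)] -/
theorem exists_hypothesesM₂_of_leavesM_shift [W.IsElliptic] (hK : IsImaginaryQuadratic K)
    {P : (W.baseChange K).toAffine.Point} {p : ℕ} (hp : p.Prime) (hp2 : p ≠ 2)
    (hρ : W.HasSurjectiveModNGaloisRep p) (hC : Literature.NumberTheory.Automorphic.chebotarev_artinRep)
    (hW : W.exists_weilPairing p) {M : ℕ} (hM : 1 ≤ M) (k : ℕ)
    (hdiv : ∀ Q : geomPoints (W.baseChange K), ∃ R, ((p ^ M : ℕ) : ℤ) • R = Q)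
    {c : K ≃ₐ[ℚ] K} (hc : c ≠ 1) (hcc : c * c = 1)
    {M₀ : ℕ} {x₀ : (W.baseChange K).toAffine.Point} (hx₀ : p ^ M₀ • x₀ = P)
    (hPx : kummerMapTorsion (W.baseChange K) _ hdiv P =
      ((p : ℤ) ^ M₀) • kummerMapTorsion (W.baseChange K) _ hdiv x₀)
    (hxord : ((p : ℤ) ^ (M - 1)) • kummerMapTorsion (W.baseChange K) _ hdiv x₀ ≠ 0)
    (ε : ℤ) (hε : ε = 1 ∨ ε = -1)
    (h53 : IsOfFinAddOrder (Affine.Point.map (W' := W) (c : K →ₐ[ℚ] K) P - ε • P))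
    (cl : ℕ → galH1Torsion (W.baseChange K) ((p ^ M : ℕ) : ℤ))
    (hc1 : cl 1 = kummerMapTorsion (W.baseChange K) _ hdiv P)
    (hcl : ∀ m : ℕ, Squarefree m →
      (∀ q ∈ m.primeFactors, IsKolyvaginPrime N W K p q ∧ FrobEqFrobInfty W K (p ^ (M + k)) q) →
      conjAct W c _ (cl m) = (ε * (-1) ^ m.primeFactors.card) • cl m ∧
      (∀ v : HeightOneSpectrum (𝓞 K), (m : 𝓞 K) ∉ v.asIdeal →
        cl m ∈ selmerLocalKer (W.baseChange K) (v.adicCompletion K) ((p ^ M : ℕ) : ℤ)) ∧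
      (∀ ℓ : ℕ, ℓ.Prime → ℓ ∣ m → ∀ v : HeightOneSpectrum (𝓞 K), (ℓ : 𝓞 K) ∈ v.asIdeal →
        ∀ a : ℕ, (((p : ℤ) ^ a) • cl m ∈
            selmerLocalKer (W.baseChange K) (v.adicCompletion K) ((p ^ M : ℕ) : ℤ) ↔
          ((p : ℤ) ^ a) • cl (m / ℓ) ∈
            (W.baseChange K).torsionLocalKer (v.adicCompletion K) ((p ^ M : ℕ) : ℤ))))
    (hdual : ∀ ℓ : ℕ, IsKolyvaginPrime N W K p ℓ ∧ FrobEqFrobInfty W K (p ^ (M + k)) ℓ →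
      ∀ ν : ℤ, (ν = 1 ∨ ν = -1) → ∀ d : galH1Torsion (W.baseChange K) ((p ^ M : ℕ) : ℤ),
      conjAct W c _ d = ν • d →
      (∀ v : HeightOneSpectrum (𝓞 K), (ℓ : 𝓞 K) ∉ v.asIdeal →
        d ∈ selmerLocalKer (W.baseChange K) (v.adicCompletion K) ((p ^ M : ℕ) : ℤ)) →
      (∀ w : InfinitePlace K, d ∈ selmerLocalKer (W.baseChange K) w.Completion ((p ^ M : ℕ) : ℤ)) →
      ∀ s ∈ selmerGroup (W.baseChange K) ((p ^ M : ℕ) : ℤ), conjAct W c _ s = ν • s →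
      ∀ a : ℕ, a < M → ∀ v : HeightOneSpectrum (𝓞 K), (ℓ : 𝓞 K) ∈ v.asIdeal →
        ((p : ℤ) ^ a) • d ∉ selmerLocalKer (W.baseChange K) (v.adicCompletion K) ((p ^ M : ℕ) : ℤ) →
        ((p : ℤ) ^ (M - 1 - a)) • s ∈
          (W.baseChange K).torsionLocalKer (v.adicCompletion K) ((p ^ M : ℕ) : ℤ))
    (hdual₂ : ∀ ℓ ℓ' : ℕ, IsKolyvaginPrime N W K p ℓ ∧ FrobEqFrobInfty W K (p ^ (M + k)) ℓ →
      IsKolyvaginPrime N W K p ℓ' ∧ FrobEqFrobInfty W K (p ^ (M + k)) ℓ' → ℓ ≠ ℓ' →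
      ∀ ν : ℤ, (ν = 1 ∨ ν = -1) → ∀ d : galH1Torsion (W.baseChange K) ((p ^ M : ℕ) : ℤ),
      conjAct W c _ d = ν • d →
      (∀ v : HeightOneSpectrum (𝓞 K), (ℓ : 𝓞 K) ∉ v.asIdeal → (ℓ' : 𝓞 K) ∉ v.asIdeal →
        d ∈ selmerLocalKer (W.baseChange K) (v.adicCompletion K) ((p ^ M : ℕ) : ℤ)) →
      (∀ w : InfinitePlace K, d ∈ selmerLocalKer (W.baseChange K) w.Completion ((p ^ M : ℕ) : ℤ)) →
      ∀ s ∈ selmerGroup (W.baseChange K) ((p ^ M : ℕ) : ℤ), conjAct W c _ s = ν • s →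
      (∀ v : HeightOneSpectrum (𝓞 K), (ℓ' : 𝓞 K) ∈ v.asIdeal →
        s ∈ (W.baseChange K).torsionLocalKer (v.adicCompletion K) ((p ^ M : ℕ) : ℤ)) →
      ∀ a : ℕ, a < M → ∀ v : HeightOneSpectrum (𝓞 K), (ℓ : 𝓞 K) ∈ v.asIdeal →
        ((p : ℤ) ^ a) • d ∉ selmerLocalKer (W.baseChange K) (v.adicCompletion K) ((p ^ M : ℕ) : ℤ) →
        ((p : ℤ) ^ (M - 1 - a)) • s ∈
          (W.baseChange K).torsionLocalKer (v.adicCompletion K) ((p ^ M : ℕ) : ℤ)) :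
    ∃ S : HypothesesM (galH1Torsion (W.baseChange K) ((p ^ M : ℕ) : ℤ))
        (HeightOneSpectrum (𝓞 K) ⊕ InfinitePlace K),
      S.Sel = selmerGroup (W.baseChange K) ((p ^ M : ℕ) : ℤ) ∧
      S.x = kummerMapTorsion (W.baseChange K) _ hdiv x₀ ∧ S.p = p ∧ S.M₀ = M₀ ∧ S.M = M ∧
      (∀ ℓ ℓ', S.Kol ℓ → S.Kol ℓ' → ℓ ≠ ℓ' → ∀ ν : ℤ, (ν = 1 ∨ ν = -1) → ∀ d, S.τ d = ν • d →
        (∀ v, v ≠ S.pl ℓ → v ≠ S.pl ℓ' → d ∈ S.Loc v) → ∀ s ∈ S.Sel, S.τ s = ν • s → s ∈ S.A ℓ' →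
        ∀ a, a < S.M → ((S.p : ℤ) ^ a) • d ∉ S.Loc (S.pl ℓ) →
          ((S.p : ℤ) ^ (S.M - 1 - a)) • s ∈ S.A ℓ) := by
  have hn0 : ((p ^ M : ℕ) : ℤ) ≠ 0 := by exact_mod_cast pow_ne_zero M hp.ne_zero
  -- `E(K)[p] = 0`
  have hbot := torsionBy_eq_bot_of_isImaginaryQuadratic W K hK hp hp2 hρ
  have hA : ∀ a : (W.baseChange K).toAffine.Point, p • a = 0 → a = 0 := fun a ha ↦ by
    have : a ∈ AddSubgroup.torsionBy (W.baseChange K).toAffine.Point (p : ℤ) := by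
      rw [mem_torsionBy_iff, natCast_zsmul]; exact ha
    rw [hbot] at this
    exact this
  -- `τ x = ε x`
  set x := kummerMapTorsion (W.baseChange K) _ hdiv x₀ with hxdef
  have hεε : ε * ε = 1 := by rcases hε with rfl | rfl <;> norm_num
  have hτx : conjAct W c _ x = ε • x := by
    rw [hxdef, conjAct_kummerMapTorsion W c _ hdiv x₀]
    -- `t = c x₀ - ε x₀` is torsion
    set t := Affine.Point.map (W' := W) (c : K →ₐ[ℚ] K) x₀ - ε • x₀ with ht
    have htP : p ^ M₀ • t = Affine.Point.map (W' := W) (c : K →ₐ[ℚ] K) P - ε • P := by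
      rw [ht, smul_sub, ← map_nsmul, hx₀, smul_comm, hx₀]
    have htors : IsOfFinAddOrder t := by
      obtain ⟨k, hk, hkt⟩ := (isOfFinAddOrder_iff_nsmul_eq_zero).mp h53
      refine (isOfFinAddOrder_iff_nsmul_eq_zero).mpr ⟨k * p ^ M₀, Nat.mul_pos hk (pow_pos hp.pos _), ?_⟩
      rw [mul_smul, htP, hkt]
    obtain ⟨s, hs⟩ := exists_pow_smul_eq_of_isOfFinAddOrder hp hA htors M
    have hker : t ∈ (kummerMapTorsion (W.baseChange K) ((p ^ M : ℕ) : ℤ) hdiv).ker := by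
      rw [kummerMapTorsion_ker]
      exact ⟨s, by rw [← hs, Nat.cast_pow]; rfl⟩
    have ht0 : kummerMapTorsion (W.baseChange K) _ hdiv t = 0 := hker
    have : Affine.Point.map (W' := W) (c : K →ₐ[ℚ] K) x₀ = t + ε • x₀ := by rw [ht]; abel
    rw [this, map_add, ht0, zero_add, map_zsmul]
  -- the local conditions at the (complex) infinite places are empty
  have hinf : ∀ (w : InfinitePlace K) (y : galH1Torsion (W.baseChange K) ((p ^ M : ℕ) : ℤ)),
      y ∈ selmerLocalKer (W.baseChange K) w.Completion ((p ^ M : ℕ) : ℤ) := fun w y ↦ by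
    haveI : IsAlgClosed w.Completion :=
      isAlgClosed_of_ringEquiv (InfinitePlace.Completion.ringEquivComplexOfIsComplex
        (hK.2.isComplex w)).symm
    rw [WeierstrassCurve.selmerLocalKer_eq_top_of_isAlgClosed]
    trivial
  -- the structure (VERBATIM the tree's `exists_hypothesesM_of_leavesM`)
  refine ⟨
    { p := p
      hp := hp
      hp2 := hp2
      M := M
      torsion := fun v ↦ by
        have := zsmul_discreteH1_torsion ((p ^ M : ℕ) : ℤ) v
        exact_mod_cast this
      τ := conjAct W c _
      τ_τ := conjAct_conjAct_of_mul_self W hcc _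
      Sel := selmerGroup (W.baseChange K) _
      τ_mem := fun s hs ↦ conjAct_mem_selmerGroup W hK.2.isComplex c _ hs
      Loc := Sum.elim (fun v ↦ selmerLocalKer (W.baseChange K) (v.adicCompletion K) _)
        (fun w ↦ selmerLocalKer (W.baseChange K) w.Completion _)
      mem_sel_iff := fun s ↦ by rw [mem_selmerGroup_iff, Sum.forall]; rfl
      Kol := fun ℓ ↦ IsKolyvaginPrime N W K p ℓ ∧ FrobEqFrobInfty W K (p ^ (M + k)) ℓ
      prime_of_kol := fun ℓ h ↦ h.1.prime
      pl := fun ℓ ↦ if h : IsKolyvaginPrime N W K p ℓ ∧ FrobEqFrobInfty W K (p ^ (M + k)) ℓ then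
          Sum.inl h.1.place else Sum.inr (Classical.arbitrary _)
      Dv := fun v n ↦ Sum.elim (fun v ↦ (n : 𝓞 K) ∈ v.asIdeal) (fun _ ↦ False) v
      dv_iff := fun ℓ hℓ v ↦ by
        rw [dif_pos hℓ]
        rcases v with v | w
        · simp only [Sum.elim_inl, Sum.inl.injEq]
          exact hℓ.1.mem_iff
        · simp
      dv_mul := fun ℓ ℓ' _ _ v ↦ by
        rcases v with v | w
        · exact natCast_mul_mem_asIdeal
        · simp
      A := fun ℓ ↦ ⨅ (v : HeightOneSpectrum (𝓞 K)) (_ : (ℓ : 𝓞 K) ∈ v.asIdeal),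
        (W.baseChange K).torsionLocalKer (v.adicCompletion K) _
      x := x
      x_mem := (mem_selmerGroup_iff _ _ _).mpr
        ⟨fun _ ↦ kummerMapTorsion_mem_selmerLocalKer _ _ _ _ x₀,
          fun _ ↦ kummerMapTorsion_mem_selmerLocalKer _ _ _ _ x₀⟩
      x_ord := hxord
      M₀ := M₀
      ε := ε
      hε := hε
      τ_x := hτx
      c := cl
      c_one := by rw [hc1, hPx]
      τ_c := fun n hn ↦ (hcl n hn.1 hn.2).1
      c_mem_loc := fun n hn v hv ↦ by
        rcases v with v | w
        · exact (hcl n hn.1 hn.2).2.1 v hv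
        · exact hinf w (cl n)
      c_mem_loc_iff := fun ℓ m hℓ hn a ↦ by
        rw [dif_pos hℓ]
        simp only [Sum.elim_inl, AddSubgroup.mem_iInf]
        have key := (hcl (ℓ * m) hn.1 hn.2).2.2 ℓ hℓ.1.prime (dvd_mul_right ℓ m) hℓ.1.place
          hℓ.1.mem_place a
        rw [Nat.mul_div_cancel_left m hℓ.1.prime.pos] at key
        rw [key]
        constructor
        · intro h v hv
          rwa [hℓ.1.mem_iff.mp hv]
        · intro h
          exact h hℓ.1.place hℓ.1.mem_place
      duality := fun ℓ hℓ ν hν d hd hoff s hs hτs a ha hat ↦ by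
        rw [dif_pos hℓ] at hoff hat
        simp only [AddSubgroup.mem_iInf]
        intro v hv
        refine hdual ℓ hℓ ν hν d hd (fun v' hv' ↦ ?_) (fun w ↦ ?_) s hs hτs a ha v hv ?_
        · exact hoff (Sum.inl v') (fun h ↦ hv' (hℓ.1.mem_iff.mpr (Sum.inl_injective h)))
        · exact hoff (Sum.inr w) (by simp)
        · rwa [hℓ.1.mem_iff.mp hv]
      cebotarev := fun r cs Nv h0 hN hτ hind b ↦ by
        obtain ⟨ℓ, hlt, hKol, hfrob, hloc⟩ := McCallum1991_cor_3_2_pow_shift_of_chebotarev (W := W)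
          (N := N) hC hK hp hp2 hρ hW hM k hc cs h0 Nv hN hτ hind b
        refine ⟨ℓ, hlt, ⟨hKol, hfrob⟩, fun i ↦ ⟨?_, fun hNi h ↦ ?_⟩⟩
        · simp only [AddSubgroup.mem_iInf]
          intro v hv
          exact (hloc i v hv).1
        · simp only [AddSubgroup.mem_iInf] at h
          exact (hloc i hKol.place hKol.mem_place).2 hNi (h hKol.place hKol.mem_place) },
    rfl, rfl, rfl, rfl, rfl, ?_⟩
  -- the two-place duality of the produced data, from `hdual₂`
  intro ℓ ℓ' hℓ hℓ' hne ν hν d hd hoff s hs hτs hsA a ha hat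
  change IsKolyvaginPrime N W K p ℓ ∧ FrobEqFrobInfty W K (p ^ (M + k)) ℓ at hℓ
  change IsKolyvaginPrime N W K p ℓ' ∧ FrobEqFrobInfty W K (p ^ (M + k)) ℓ' at hℓ'
  dsimp only at hoff hsA hat ⊢
  rw [dif_pos hℓ] at hoff hat
  rw [dif_pos hℓ'] at hoff
  simp only [AddSubgroup.mem_iInf] at hsA ⊢
  intro v hv
  refine hdual₂ ℓ ℓ' hℓ hℓ' hne ν hν d hd (fun v' hv' hv'' ↦ ?_) (fun w ↦ ?_) s hs hτs
    (fun v' hv' ↦ hsA v' hv') a ha v hv ?_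
  · exact hoff (Sum.inl v') (fun h ↦ hv' (hℓ.1.mem_iff.mpr (Sum.inl_injective h)))
      (fun h ↦ hv'' (hℓ'.1.mem_iff.mpr (Sum.inl_injective h)))
  · exact hoff (Sum.inr w) (by simp) (by simp)
  · rwa [hℓ.1.mem_iff.mp hv]

/-- **`p^m · Ш(E/K)[p^∞] = 0` at one odd prime `p` with `ρ̄_{E,p}` onto, for every `m` with `p^{m+1} ∤ P` in `E(K)`,
from the mod-`p^M` leaves (A) + (B) + (B₂) at DEPTH `M + k`** — twin of the tree's
`pow_smul_sha_primary_eq_zero_at_of_leavesM₂` (Kolyvagin's exponent; McCallum 1991 §1 Theorem in exponent form,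
Lemma 5.1) with the leaf slice `hleaves` quantified over depth-`(M+k)` Kolyvagin primes; proof = the tree's with
`exists_hypothesesM₂_of_leavesM_shift`. [cite: McCallumLMS1991, §1 Theorem (Kolyvagin), Lemma 5.1, §2 Prop. 2.2, §§4–5]
[cite: GrossLMS1991, §1 Thm. 1.3 (2), §10] -/
theorem pow_smul_sha_primary_eq_zero_at_of_leavesM₂_shift [W.IsElliptic] (hK : IsImaginaryQuadratic K)
    {P : (W.baseChange K).toAffine.Point} (hnt : ¬ IsOfFinAddOrder P) {p : ℕ} (hp : p.Prime)
    (hp2 : p ≠ 2) (hρ : W.HasSurjectiveModNGaloisRep p) {m : ℕ}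
    (hm : ∀ Q : (W.baseChange K).toAffine.Point, p ^ (m + 1) • Q ≠ P)
    (hC : Literature.NumberTheory.Automorphic.chebotarev_artinRep) (hW : W.exists_weilPairing p) (k : ℕ)
    (hleaves : ∀ {M : ℕ} (_hM : 1 ≤ M)
      (hdiv : ∀ Q : geomPoints (W.baseChange K), ∃ R, ((p ^ M : ℕ) : ℤ) • R = Q)
      (c : K ≃ₐ[ℚ] K) (_hc : c ≠ 1),
      ∃ (ε : ℤ) (cl : ℕ → galH1Torsion (W.baseChange K) ((p ^ M : ℕ) : ℤ)),
        (ε = 1 ∨ ε = -1) ∧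
        IsOfFinAddOrder (Affine.Point.map (W' := W) (c : K →ₐ[ℚ] K) P - ε • P) ∧
        cl 1 = kummerMapTorsion (W.baseChange K) _ hdiv P ∧
        (∀ m : ℕ, Squarefree m →
          (∀ q ∈ m.primeFactors, IsKolyvaginPrime N W K p q ∧ FrobEqFrobInfty W K (p ^ (M + k)) q) →
          conjAct W c _ (cl m) = (ε * (-1) ^ m.primeFactors.card) • cl m ∧
          (∀ v : HeightOneSpectrum (𝓞 K), (m : 𝓞 K) ∉ v.asIdeal →
            cl m ∈ selmerLocalKer (W.baseChange K) (v.adicCompletion K) ((p ^ M : ℕ) : ℤ)) ∧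
          (∀ ℓ : ℕ, ℓ.Prime → ℓ ∣ m → ∀ v : HeightOneSpectrum (𝓞 K), (ℓ : 𝓞 K) ∈ v.asIdeal →
            ∀ a : ℕ, (((p : ℤ) ^ a) • cl m ∈
                selmerLocalKer (W.baseChange K) (v.adicCompletion K) ((p ^ M : ℕ) : ℤ) ↔
              ((p : ℤ) ^ a) • cl (m / ℓ) ∈
                (W.baseChange K).torsionLocalKer (v.adicCompletion K) ((p ^ M : ℕ) : ℤ)))) ∧
        (∀ ℓ : ℕ, IsKolyvaginPrime N W K p ℓ ∧ FrobEqFrobInfty W K (p ^ (M + k)) ℓ →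
          ∀ ν : ℤ, (ν = 1 ∨ ν = -1) → ∀ d : galH1Torsion (W.baseChange K) ((p ^ M : ℕ) : ℤ),
          conjAct W c _ d = ν • d →
          (∀ v : HeightOneSpectrum (𝓞 K), (ℓ : 𝓞 K) ∉ v.asIdeal →
            d ∈ selmerLocalKer (W.baseChange K) (v.adicCompletion K) ((p ^ M : ℕ) : ℤ)) →
          (∀ w : InfinitePlace K,
            d ∈ selmerLocalKer (W.baseChange K) w.Completion ((p ^ M : ℕ) : ℤ)) →
          ∀ s ∈ selmerGroup (W.baseChange K) ((p ^ M : ℕ) : ℤ), conjAct W c _ s = ν • s →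
          ∀ a : ℕ, a < M → ∀ v : HeightOneSpectrum (𝓞 K), (ℓ : 𝓞 K) ∈ v.asIdeal →
            ((p : ℤ) ^ a) • d ∉
              selmerLocalKer (W.baseChange K) (v.adicCompletion K) ((p ^ M : ℕ) : ℤ) →
            ((p : ℤ) ^ (M - 1 - a)) • s ∈
              (W.baseChange K).torsionLocalKer (v.adicCompletion K) ((p ^ M : ℕ) : ℤ)) ∧
        (∀ ℓ ℓ' : ℕ, IsKolyvaginPrime N W K p ℓ ∧ FrobEqFrobInfty W K (p ^ (M + k)) ℓ →
          IsKolyvaginPrime N W K p ℓ' ∧ FrobEqFrobInfty W K (p ^ (M + k)) ℓ' → ℓ ≠ ℓ' →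
          ∀ ν : ℤ, (ν = 1 ∨ ν = -1) → ∀ d : galH1Torsion (W.baseChange K) ((p ^ M : ℕ) : ℤ),
          conjAct W c _ d = ν • d →
          (∀ v : HeightOneSpectrum (𝓞 K), (ℓ : 𝓞 K) ∉ v.asIdeal → (ℓ' : 𝓞 K) ∉ v.asIdeal →
            d ∈ selmerLocalKer (W.baseChange K) (v.adicCompletion K) ((p ^ M : ℕ) : ℤ)) →
          (∀ w : InfinitePlace K,
            d ∈ selmerLocalKer (W.baseChange K) w.Completion ((p ^ M : ℕ) : ℤ)) →
          ∀ s ∈ selmerGroup (W.baseChange K) ((p ^ M : ℕ) : ℤ), conjAct W c _ s = ν • s →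
          (∀ v : HeightOneSpectrum (𝓞 K), (ℓ' : 𝓞 K) ∈ v.asIdeal →
            s ∈ (W.baseChange K).torsionLocalKer (v.adicCompletion K) ((p ^ M : ℕ) : ℤ)) →
          ∀ a : ℕ, a < M → ∀ v : HeightOneSpectrum (𝓞 K), (ℓ : 𝓞 K) ∈ v.asIdeal →
            ((p : ℤ) ^ a) • d ∉
              selmerLocalKer (W.baseChange K) (v.adicCompletion K) ((p ^ M : ℕ) : ℤ) →
            ((p : ℤ) ^ (M - 1 - a)) • s ∈
              (W.baseChange K).torsionLocalKer (v.adicCompletion K) ((p ^ M : ℕ) : ℤ))) :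
    ∀ d : (W.baseChange K).sha, (∃ j : ℕ, p ^ j • d = 0) → p ^ m • d = 0 := by
  haveI : (W.baseChange K).IsElliptic := inferInstanceAs (W.map (algebraMap ℚ K)).IsElliptic
  obtain ⟨c, hc, hcc⟩ := exists_conj_of_isImaginaryQuadratic K hK
  -- `E(K)[p] = 0`, `M₀`, `x₀` (McCallum Lemma 5.1)
  have hbot := torsionBy_eq_bot_of_isImaginaryQuadratic W K hK hp hp2 hρ
  have hA : ∀ a : (W.baseChange K).toAffine.Point, p • a = 0 → a = 0 := fun a ha ↦ by
    have : a ∈ AddSubgroup.torsionBy (W.baseChange K).toAffine.Point (p : ℤ) := by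
      rw [mem_torsionBy_iff, natCast_zsmul]; exact ha
    rw [hbot] at this
    exact this
  obtain ⟨M₀, x₀, hx₀, -, hgen⟩ := exists_kummer_generator_pow (W.baseChange K) hp hA hnt
  -- `M₀ ≤ m`: otherwise `p^{m+1} (p^{M₀-(m+1)} x₀) = P`
  have hM₀m : M₀ ≤ m := by
    by_contra h
    refine hm (p ^ (M₀ - (m + 1)) • x₀) ?_
    rw [smul_smul, ← pow_add, show m + 1 + (M₀ - (m + 1)) = M₀ by omega, hx₀]
  have hdivj : ∀ j : ℕ, ∀ Q : geomPoints (W.baseChange K), ∃ R, ((p ^ j : ℕ) : ℤ) • R = Q :=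
    fun j ↦ (W.baseChange K).zsmul_geomPoints_surjective_holds
      (by exact_mod_cast pow_ne_zero j hp.ne_zero)
  -- descent data with two-place duality at every level `p^j`, `j ≥ 1`, from the leaves at THIS `p`
  have key : ∀ j : ℕ, 1 ≤ j →
      ∃ S : HypothesesM (galH1Torsion (W.baseChange K) ((p ^ j : ℕ) : ℤ))
          (HeightOneSpectrum (𝓞 K) ⊕ InfinitePlace K),
        S.Sel = selmerGroup (W.baseChange K) ((p ^ j : ℕ) : ℤ) ∧
        S.x = kummerMapTorsion (W.baseChange K) _ (hdivj j) x₀ ∧ S.p = p ∧ S.M₀ = M₀ ∧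
        S.M = j ∧
        (∀ ℓ ℓ', S.Kol ℓ → S.Kol ℓ' → ℓ ≠ ℓ' → ∀ ν : ℤ, (ν = 1 ∨ ν = -1) → ∀ d, S.τ d = ν • d →
          (∀ v, v ≠ S.pl ℓ → v ≠ S.pl ℓ' → d ∈ S.Loc v) →
          ∀ s ∈ S.Sel, S.τ s = ν • s → s ∈ S.A ℓ' →
          ∀ a, a < S.M → ((S.p : ℤ) ^ a) • d ∉ S.Loc (S.pl ℓ) →
            ((S.p : ℤ) ^ (S.M - 1 - a)) • s ∈ S.A ℓ) := by
    intro j hj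
    obtain ⟨ε, cl, hε, h53, hc1, hcl, hdual, hdual₂⟩ := hleaves hj (hdivj j) c hc
    obtain ⟨hPx, hxord⟩ := hgen j (by omega) (hdivj j)
    exact exists_hypothesesM₂_of_leavesM_shift (N := N) W hK hp hp2 hρ hC hW hj k (hdivj j) hc hcc
      hx₀ hPx hxord ε hε h53 cl hc1 hcl hdual hdual₂
  choose S hS using key
  intro d hd
  have hM₀ : p ^ M₀ • d = 0 :=
    pow_M₀_smul_sha_primary_eq_zero_of_hypothesesM_of_le (W.baseChange K) hp M₀ 1 S
      (fun j hj ↦ (hS j hj).2.2.1) (fun j hj ↦ (hS j hj).2.2.2.1) (fun j hj ↦ (hS j hj).1)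
      (fun j hj ↦ by
        rw [(hS j hj).2.1, AddMonoidHom.mem_ker]
        exact torsionH1ToH1_kummerMapTorsion _ _ _ x₀)
      (fun j hj ↦ (hS j hj).2.2.2.2.2) d hd
  rw [show m = (m - M₀) + M₀ by omega, pow_add, mul_smul, hM₀, smul_zero]

end Summit.BirchSwinnertonDyer.BirchSwinnertonDyer.Theorems.ShimuraKolyvaginOrder
end
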